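import Summits.CriticalPhenomena.CardyFormulaZ2.Theorems.CardyComplexConeParafermionToSLESixFamiliesDiamondIdentifyLoop
import Summits.CriticalPhenomena.CardyFormulaZ2.Theorems.CardyComplexConeParafermionToSLESixFamiliesDiamondIdentifyEnum
import Summits.CriticalPhenomena.CardyFormulaZ2.Theorems.CardyComplexConeParafermionToSLESixFamiliesDiamondIdentifyPieces
import HarnessLib

/-!
# Line `potential-darboux-picard-diamond`, stub S4′ (`stub_identifyPotentialPh`): the subdivision of the boundary of a marked diamond at corners and marks

Helper file of the stub `stub_identifyPotentialPh` of crux `ParafermionToSLESixFamilies` (stmt-CriticalPhenomena-11389).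
Step (iii) of the identification: the boundary loop `ℓ` of a marked diamond (`exists_boundaryLoop`) subdivided at the
four corners and the two marks (`exists_periodic_enum` applied to the corner and mark parameters) is a cyclic chain of
`N ∈ {4, 5, 6}` ORIENTED BOUNDARY SEGMENTS `[ℓ (t j), ℓ (t (j+1))]` (`isBdrySegment_of_piece`) covering the frontier,
on each of which `ℓ` is affine, whose TURN exponents `θ_j = ⅔·arg((v_{j+2} − v_{j+1})/(v_{j+1} − v_j)) + π/3·[v_{j+1}
is a mark]` (the exponents of (TURN) in `ExactPotentialTracePh`) are `π/3` or `2π/3` and add up to `2π` over a period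
(`exists_boundaryChain`, registered helper of the crux item). With (DIR) in the limit (`trace_sub_mem_ray`) this makes
the boundary trace of the potential limit a closed left-turning polygonal chain with the data of
`leftTurningHull_props` / `monotoneArg_of_pieces`.
-/

noncomputable section

namespace Summit.CriticalPhenomena.CardyFormulaZ2.Cruxes.ParafermionToSLESixFamilies.PotentialDarbouxPicardDiamond

open scoped Topology ComplexConjugate BigOperators
open Filter Set Metric Complex
open Literature.Probability.RandomPlanarGeometry

/-- The quarter-period grid `(π/2)ℤ` inside `[0, 2π)` consists of `0, π/2, π, 3π/2`. -/
theorem grid_mem_of_lt {x : ℝ} {m : ℤ} (hx : x = m * (Real.pi / 2)) (h0 : 0 ≤ x) (hlt : x < 2 * Real.pi) :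
    x = 0 ∨ x = Real.pi / 2 ∨ x = Real.pi ∨ x = 3 * Real.pi / 2 := by
  have hπ := Real.pi_pos
  have hm : (m : ℝ) < 4 := by nlinarith
  have hm0 : (0 : ℝ) ≤ m := by nlinarith
  have hm4 : m < 4 := by exact_mod_cast hm
  have hm0' : 0 ≤ m := by exact_mod_cast hm0
  interval_cases m
  · left; rw [hx]; simp
  · right; left; rw [hx]; simp
  · right; right; left; rw [hx]; push_cast; ring
  · right; right; right; rw [hx]; push_cast; ring

/-- **The subdivision of the boundary of a marked diamond at corners and marks.** -/
theorem exists_boundaryChain : ∀ (D : DobrushinDomain), IsMarkedDiamond D → ∃ (N : ℕ) (ℓ : ℝ → ℂ) (t : ℕ → ℝ) (c : ℂ), 4 ≤ N ∧ c ∈ D.carrier ∧ Convex ℝ D.carrier ∧ Continuous ℓ ∧ (∀ s : ℝ, ℓ (s + 2 * Real.pi) = ℓ s) ∧ Set.range ℓ = frontier D.carrier ∧ Set.InjOn ℓ (Set.Ico 0 (2 * Real.pi)) ∧ t 0 = 0 ∧ (∀ j, t j < t (j + 1)) ∧ (∀ j, t (j + N) = t j + 2 * Real.pi) ∧ (∀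 j, IsBdrySegment D (ℓ (t j)) (ℓ (t (j + 1)))) ∧ (∀ (j : ℕ) (s : ℝ), t j ≤ s → s ≤ t (j + 1) → ℓ s = ℓ (t j) + (((s - t j) / (t (j + 1) - t j) : ℝ) : ℂ) * (ℓ (t (j + 1)) - ℓ (t j))) ∧ (∀ j, ((ℓ (t (j + 2)) - ℓ (t (j + 1))) / (ℓ (t (j + 1)) - ℓ (t j))).arg = 0 ∨ ((ℓ (t (j + 2)) - ℓ (t (j + 1))) / (ℓ (t (j + 1)) - ℓ (t j))).arg = Real.pi / 2) ∧ ∑ j ∈ Finset.range N, ((ℓ (t (j + 2)) - ℓ (t (j + 1))) / (ℓ (t (j + 1)) - ℓ (t j))).arg = 2 * Real.pi ∧ (∀ j, (2 / 3 : ℝ) * ((ℓ (t (j + 2)) - ℓ (t (j + 1))) / (ℓ (t (j + 1)) - ℓ (t j))).arg + Real.pi / 3 * markInd D (ℓ (t (j + 1))) = Real.pi / 3 ∨ (2 / 3 : ℝ) * ((ℓ (t (j + 2)) - ℓ (t (j + 1))) / (ℓ (t (j + 1)) - ℓ (t j))).arg + Real.pi / 3 * markInd D (ℓ (t (j + 1)))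 = 2 * Real.pi / 3) ∧ ∑ j ∈ Finset.range N, ((2 / 3 : ℝ) * ((ℓ (t (j + 2)) - ℓ (t (j + 1))) / (ℓ (t (j + 1)) - ℓ (t j))).arg + Real.pi / 3 * markInd D (ℓ (t (j + 1)))) = 2 * Real.pi := by
  intro D hD
  classical
  obtain ⟨ℓ, P, c, hc, hconv, hℓc, hper, hrange, hinj, hPper, hPne, hpiece, hturn, hleft⟩ := exists_boundaryLoop D hD
  have hπ := Real.pi_pos
  set L : ℝ := 2 * Real.pi with hL
  have hL0 : 0 < L := by positivity
  -- mark parameters in the fundamental period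
  have hmark : ∀ i : Fin 2, ∃ m : ℝ, m ∈ Ico (0:ℝ) L ∧ ℓ m = D.pt i := by
    intro i
    have hfr : D.pt i ∈ Set.range ℓ := by rw [hrange]; exact D.pt_mem_frontier i
    obtain ⟨s, hs⟩ := hfr
    obtain ⟨s₀, hs₀, n, -, hℓs₀⟩ := loop_reduce hL0 hper s
    exact ⟨s₀, hs₀, by rw [hℓs₀, hs]⟩
  obtain ⟨ma, hma, hℓa⟩ := hmark 0
  obtain ⟨mb, hmb, hℓb⟩ := hmark 1
  have hab : D.pt 0 ≠ D.pt 1 := fun h => by have := D.pt_injective h; exact absurd this (by decide)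
  have hmab : ma ≠ mb := fun h => hab (by rw [← hℓa, ← hℓb, h])
  -- the corner and mark parameters
  set C : Finset ℝ := {0, Real.pi / 2, Real.pi, 3 * Real.pi / 2} with hC
  set T : Finset ℝ := insert ma (insert mb C) with hT
  have hCT : C ⊆ T := fun x hx => by
    rw [hT]; exact Finset.mem_insert_of_mem (Finset.mem_insert_of_mem hx)
  have hCgrid : ∀ x ∈ C, ∃ m : ℕ, x = m * (Real.pi / 2) := by
    intro x hx
    simp only [hC, Finset.mem_insert, Finset.mem_singleton] at hx
    rcases hx with rfl | rfl | rfl | rfl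
    · exact ⟨0, by simp⟩
    · exact ⟨1, by simp⟩
    · exact ⟨2, by push_cast; ring⟩
    · exact ⟨3, by push_cast; ring⟩
  have hgridC : ∀ m : ℕ, ((m % 4 : ℕ) : ℝ) * (Real.pi / 2) ∈ C := by
    intro m
    have h4 : m % 4 < 4 := Nat.mod_lt _ (by norm_num)
    simp only [hC, Finset.mem_insert, Finset.mem_singleton]
    interval_cases h : m % 4
    · left; simp
    · right; left; simp
    · right; right; left; push_cast; ring
    · right; right; right; push_cast; ring
  have hCrange : ∀ x ∈ C, 0 ≤ x ∧ x < L := by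
    intro x hx
    simp only [hC, Finset.mem_insert, Finset.mem_singleton] at hx
    rcases hx with rfl | rfl | rfl | rfl <;> constructor <;> (try positivity) <;> rw [hL] <;> linarith
  have h0T : (0:ℝ) ∈ T := hCT (by simp [hC])
  have hTrange : ∀ x ∈ T, 0 ≤ x ∧ x < L := by
    intro x hx
    rw [hT, Finset.mem_insert, Finset.mem_insert] at hx
    rcases hx with rfl | rfl | hx
    · exact ⟨hma.1, hma.2⟩
    · exact ⟨hmb.1, hmb.2⟩
    · exact hCrange x hx
  have hTcases : ∀ x ∈ T, x = ma ∨ x = mb ∨ x ∈ C := by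
    intro x hx
    rw [hT, Finset.mem_insert, Finset.mem_insert] at hx
    exact hx
  -- the periodic enumeration
  obtain ⟨N, t, hNcard, hNpos, ht0, htlt, htper, htnn, htT, hTt, hgap, hsum⟩ :=
    exists_periodic_enum T L hL0 h0T hTrange
  -- `N ≥ 4`
  have hCcard : C.card = 4 := by
    rw [hC, Finset.card_insert_of_notMem, Finset.card_insert_of_notMem, Finset.card_insert_of_notMem,
      Finset.card_singleton]
    · simp only [Finset.mem_singleton]; linarith
    · simp only [Finset.mem_insert, Finset.mem_singleton]; push Not; constructor <;> linarith
    · simp only [Finset.mem_insert, Finset.mem_singleton]; push Not; exact ⟨by linarith, by linarith, by linarith⟩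
  have hN4 : 4 ≤ N := by rw [hNcard, ← hCcard]; exact Finset.card_le_card hCT
  -- grid points and mark parameters are not strictly inside a piece
  have hgapG : ∀ (j : ℕ) (m : ℕ), ¬ (t j < m * (Real.pi / 2) ∧ m * (Real.pi / 2) < t (j + 1)) := by
    intro j m hcon
    have hm : (m : ℝ) * (Real.pi / 2) = ((m % 4 : ℕ) : ℝ) * (Real.pi / 2) + (((m / 4 : ℕ) : ℤ) : ℝ) * L := by
      rw [Int.cast_natCast]
      have : (m : ℝ) = (m % 4 : ℕ) + 4 * (m / 4 : ℕ) := by exact_mod_cast (Nat.mod_add_div m 4).symm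
      rw [this, hL]; ring
    rw [hm] at hcon
    exact hgap j _ (hCT (hgridC m)) _ hcon
  have hnomark : ∀ (j : ℕ) (s : ℝ), t j < s → s < t (j + 1) → ℓ s ≠ D.pt 0 ∧ ℓ s ≠ D.pt 1 := by
    intro j s hs1 hs2
    obtain ⟨s₀, hs₀, n, hsn, hℓs₀⟩ := loop_reduce hL0 hper s
    have key : ∀ m : ℝ, m ∈ Ico (0:ℝ) L → m ∈ T → ℓ s ≠ ℓ m := by
      intro m hm hmT heq
      have : s₀ = m := hinj hs₀ hm (by rw [hℓs₀, heq])
      rw [this] at hsn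
      exact hgap j m hmT n ⟨by rw [← hsn]; exact hs1, by rw [← hsn]; exact hs2⟩
    refine ⟨?_, ?_⟩
    · rw [← hℓa]; exact key ma hma (by rw [hT]; exact Finset.mem_insert_self _ _)
    · rw [← hℓb]; exact key mb hmb (by rw [hT]; exact Finset.mem_insert_of_mem (Finset.mem_insert_self _ _))
  -- each piece lies in a quarter period: side index `k j`
  set k : ℕ → ℕ := fun j => ⌊t j / (Real.pi / 2)⌋₊ with hk
  have hkj : ∀ j, (k j : ℝ) * (Real.pi / 2) ≤ t j ∧ t (j + 1) ≤ (k j + 1) * (Real.pi / 2) := fun j =>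
    piece_within_quarter (htnn j) (hgapG j)
  have hseg : ∀ j, IsBdrySegment D (ℓ (t j)) (ℓ (t (j + 1))) ∧ ∀ s : ℝ, t j ≤ s → s ≤ t (j + 1) →
      ℓ s = ℓ (t j) + (((s - t j) / (t (j + 1) - t j) : ℝ) : ℂ) * (ℓ (t (j + 1)) - ℓ (t j)) := fun j =>
    isBdrySegment_of_piece D ℓ P (k j) (t j) (t (j + 1)) hrange hPne hpiece hleft (hkj j).1 (htlt j) (hkj j).2
      (hnomark j)
  -- local description of `ℓ` on the quarter period of piece `j`
  have hπ2 : 0 < Real.pi / 2 := by positivity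
  have hloc : ∀ (kk : ℕ) (s : ℝ), (kk : ℝ) * (Real.pi / 2) ≤ s → s ≤ (kk + 1) * (Real.pi / 2) →
      ℓ s = P kk + (((s - kk * (Real.pi / 2)) / (Real.pi / 2) : ℝ) : ℂ) * (P (kk + 1) - P kk) := by
    intro kk s hs1 hs2
    have h := hpiece kk ((s - kk * (Real.pi / 2)) / (Real.pi / 2)) (div_nonneg (by linarith) hπ2.le)
      (by rw [div_le_one hπ2]; linarith)
    rw [show ((kk : ℝ) + (s - kk * (Real.pi / 2)) / (Real.pi / 2)) * (Real.pi / 2) = s by field_simp; ring] at h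
    exact h
  -- the turning exponent at `v (j+1)` as a function of the parameter `t (j+1)`
  set g : ℝ → ℝ := fun s => (if ∃ m : ℤ, s = m * (Real.pi / 2) then Real.pi / 3 else 0) +
    Real.pi / 3 * markInd D (ℓ s) with hg
  set g₂ : ℝ → ℝ := fun s => if ∃ m : ℤ, s = m * (Real.pi / 2) then Real.pi / 2 else 0 with hg₂
  have hmarkInd : ∀ v : ℂ, markInd D v = 0 ∨ markInd D v = 1 := fun v => by
    unfold markInd; split_ifs
    · exact Or.inr rfl
    · exact Or.inl rfl
  have hθ : ∀ j, ((2 / 3 : ℝ) * ((ℓ (t (j + 2)) - ℓ (t (j + 1))) / (ℓ (t (j + 1)) - ℓ (t j))).arg +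
      Real.pi / 3 * markInd D (ℓ (t (j + 1))) = g (t (j + 1)) ∧
      (g (t (j + 1)) = Real.pi / 3 ∨ g (t (j + 1)) = 2 * Real.pi / 3)) ∧
      (((ℓ (t (j + 2)) - ℓ (t (j + 1))) / (ℓ (t (j + 1)) - ℓ (t j))).arg = g₂ (t (j + 1)) ∧
      (g₂ (t (j + 1)) = 0 ∨ g₂ (t (j + 1)) = Real.pi / 2)) := by
    intro j
    obtain ⟨hk1, hk2⟩ := hkj j
    obtain ⟨hk1', hk2'⟩ := hkj (j + 1)
    have ht01 := htlt j
    have ht12 := htlt (j + 1)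
    set kk := k j with hkk
    have hΔ : P (kk + 1) - P kk ≠ 0 := sub_ne_zero.2 (hPne kk).symm
    rcases hk2.eq_or_lt with hA | hB
    · -- corner: `t (j+1) = (k+1) π/2`
      have hk' : k (j + 1) = kk + 1 := by
        show ⌊t (j + 1) / (Real.pi / 2)⌋₊ = kk + 1
        rw [hA, mul_div_assoc, div_self hπ2.ne', mul_one]
        exact_mod_cast Nat.floor_natCast (kk + 1)
      rw [hk'] at hk1' hk2'
      have hv1 : ℓ (t (j + 1)) = P (kk + 1) := by
        rw [hloc kk (t (j + 1)) (by linarith) hk2, hA]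
        rw [show (((kk : ℝ) + 1) * (Real.pi / 2) - kk * (Real.pi / 2)) / (Real.pi / 2) = 1 by field_simp; ring]
        push_cast; ring
      set r : ℝ := (t j - kk * (Real.pi / 2)) / (Real.pi / 2) with hr
      set r2 : ℝ := (t (j + 2) - (kk + 1 : ℕ) * (Real.pi / 2)) / (Real.pi / 2) with hr2
      have hr1 : r < 1 := by rw [hr, div_lt_one hπ2]; linarith
      have hr2pos : 0 < r2 := by rw [hr2]; apply div_pos _ hπ2; push_cast; linarith
      have hv0 : ℓ (t j) = P kk + (r : ℂ) * (P (kk + 1) - P kk) := hloc kk (t j) hk1 (by linarith)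
      have hv2 : ℓ (t (j + 2)) = P (kk + 1) + (r2 : ℂ) * (P (kk + 1 + 1) - P (kk + 1)) :=
        hloc (kk + 1) (t (j + 2)) (by exact_mod_cast hk1'.trans ht12.le) (by exact_mod_cast hk2')
      obtain ⟨ρ, hρ, hρI⟩ := hturn kk
      have harg : ((ℓ (t (j + 2)) - ℓ (t (j + 1))) / (ℓ (t (j + 1)) - ℓ (t j))).arg = Real.pi / 2 := by
        have h1r : (0:ℝ) < 1 - r := by linarith
        refine arg_div_of_pos_real_mul_I (w := ((1 - r : ℝ) : ℂ) * (P (kk + 2) - P (kk + 1))) (x := r2 / (1 - r))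
          (div_pos hr2pos h1r) hρ ?_ ?_
        · rw [hv1, hv0, show P (kk + 1) - (P kk + (r : ℂ) * (P (kk + 1) - P kk)) = ((1 - r : ℝ) : ℂ) * (P (kk + 1) - P kk)
            by push_cast; ring, mul_div_mul_left _ _ (by exact_mod_cast h1r.ne'), hρI]
        · rw [hv2, hv1, show kk + 1 + 1 = kk + 2 from rfl]
          have hne : (1 : ℂ) - r ≠ 0 := by
            have : ((1 - r : ℝ) : ℂ) ≠ 0 := by exact_mod_cast h1r.ne'
            push_cast at this; exact this
          push_cast; field_simp; ring
      have hgrid : ∃ m : ℤ, t (j + 1) = m * (Real.pi / 2) := ⟨kk + 1, by rw [hA]; push_cast; ring⟩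
      have hgval : g (t (j + 1)) = Real.pi / 3 + Real.pi / 3 * markInd D (ℓ (t (j + 1))) := by
        simp only [hg]; rw [if_pos hgrid]
      have hg₂val : g₂ (t (j + 1)) = Real.pi / 2 := by simp only [hg₂]; rw [if_pos hgrid]
      refine ⟨⟨by rw [harg, hgval]; ring, ?_⟩, by rw [harg, hg₂val], Or.inr hg₂val⟩
      rw [hgval]
      rcases hmarkInd (ℓ (t (j + 1))) with h | h <;> rw [h]
      · left; ring
      · right; ring
    · -- mark inside a side: `t (j+1) < (k+1) π/2`
      have hk' : k (j + 1) = kk := by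
        show ⌊t (j + 1) / (Real.pi / 2)⌋₊ = kk
        rw [Nat.floor_eq_iff (div_nonneg (htnn _) hπ2.le), le_div_iff₀ hπ2, div_lt_iff₀ hπ2]
        exact ⟨by linarith, by linarith⟩
      rw [hk'] at hk1' hk2'
      have hngrid : ¬ ∃ m : ℤ, t (j + 1) = m * (Real.pi / 2) := by
        rintro ⟨m, hm⟩
        have h1 : (kk : ℝ) * (Real.pi / 2) < m * (Real.pi / 2) := by rw [← hm]; linarith
        have h2 : (m : ℝ) * (Real.pi / 2) < (kk + 1) * (Real.pi / 2) := by rw [← hm]; exact hB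
        have h1' : (kk : ℝ) < m := lt_of_mul_lt_mul_right h1 hπ2.le
        have h2' : (m : ℝ) < kk + 1 := lt_of_mul_lt_mul_right h2 hπ2.le
        have h3 : ((kk : ℤ) : ℝ) < m := by push_cast; exact h1'
        have h4 : (m : ℝ) < ((kk + 1 : ℤ) : ℝ) := by push_cast; exact h2'
        have : (kk : ℤ) < m := by exact_mod_cast h3
        have : m < kk + 1 := by exact_mod_cast h4
        omega
      -- `v (j+1)` is a mark
      have hmk : markInd D (ℓ (t (j + 1))) = 1 := by
        obtain ⟨x, hxT, n, hxn⟩ := htT (j + 1)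
        have hℓx : ℓ (t (j + 1)) = ℓ x := by
          rw [hxn, show x + (n : ℝ) * L = x + ((n : ℤ) : ℝ) * L by push_cast; ring]; exact loop_int_periodic hper n x
        rcases hTcases x hxT with rfl | rfl | hxC
        · unfold markInd; rw [if_pos (Or.inl (by rw [hℓx, hℓa]))]
        · unfold markInd; rw [if_pos (Or.inr (by rw [hℓx, hℓb]))]
        · exfalso
          obtain ⟨m, hm⟩ := hCgrid x hxC
          exact hngrid ⟨(m : ℤ) + 4 * n, by rw [hxn, hm, hL]; push_cast; ring⟩
      set r : ℝ := (t j - kk * (Real.pi / 2)) / (Real.pi / 2) with hr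
      set r1 : ℝ := (t (j + 1) - kk * (Real.pi / 2)) / (Real.pi / 2) with hr1
      set r2 : ℝ := (t (j + 2) - kk * (Real.pi / 2)) / (Real.pi / 2) with hr2
      have hrr1 : r < r1 := by rw [hr, hr1]; exact div_lt_div_of_pos_right (by linarith) hπ2
      have hr12 : r1 < r2 := by rw [hr1, hr2]; exact div_lt_div_of_pos_right (by linarith) hπ2
      have hv0 : ℓ (t j) = P kk + (r : ℂ) * (P (kk + 1) - P kk) := hloc kk (t j) hk1 (by linarith)
      have hv1 : ℓ (t (j + 1)) = P kk + (r1 : ℂ) * (P (kk + 1) - P kk) := hloc kk (t (j + 1)) (by linarith) hk2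
      have hv2 : ℓ (t (j + 2)) = P kk + (r2 : ℂ) * (P (kk + 1) - P kk) := hloc kk (t (j + 2)) (by linarith) hk2'
      have harg : ((ℓ (t (j + 2)) - ℓ (t (j + 1))) / (ℓ (t (j + 1)) - ℓ (t j))).arg = 0 := by
        refine arg_div_of_pos_real (x := (r2 - r1) / (r1 - r)) (div_pos (by linarith) (by linarith)) ?_ ?_
        · rw [hv1, hv0]
          rw [show P kk + (r1 : ℂ) * (P (kk + 1) - P kk) - (P kk + (r : ℂ) * (P (kk + 1) - P kk)) =
            ((r1 - r : ℝ) : ℂ) * (P (kk + 1) - P kk) by push_cast; ring]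
          exact mul_ne_zero (by exact_mod_cast (show r1 - r ≠ 0 by linarith)) hΔ
        · rw [hv2, hv1, hv0]
          have hne : ((r1 - r : ℝ) : ℂ) ≠ 0 := by exact_mod_cast (show r1 - r ≠ 0 by linarith)
          push_cast at hne ⊢; field_simp; ring
      have hgval : g (t (j + 1)) = Real.pi / 3 := by
        simp only [hg]; rw [if_neg hngrid, hmk]; ring
      have hg₂val : g₂ (t (j + 1)) = 0 := by simp only [hg₂]; rw [if_neg hngrid]
      exact ⟨⟨by rw [harg, hmk, hgval]; ring, Or.inl hgval⟩, by rw [harg, hg₂val], Or.inl hg₂val⟩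
  -- the sum of the exponents over a period
  have hgper : ∀ s, g (s + L) = g s := by
    intro s
    have hiff : (∃ m : ℤ, s + L = m * (Real.pi / 2)) ↔ ∃ m : ℤ, s = m * (Real.pi / 2) := by
      constructor
      · rintro ⟨m, hm⟩; exact ⟨m - 4, by rw [hL] at hm; push_cast; linarith⟩
      · rintro ⟨m, hm⟩; exact ⟨m + 4, by rw [hm, hL]; push_cast; ring⟩
    simp only [hg]
    rw [show s + L = s + 2 * Real.pi from rfl, hper]
    by_cases h : ∃ m : ℤ, s = m * (Real.pi / 2)
    · rw [if_pos h, if_pos ((show s + 2 * Real.pi = s + L from rfl) ▸ hiff.2 h)]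
    · rw [if_neg h, if_neg (fun h' => h (hiff.1 ((show s + 2 * Real.pi = s + L from rfl) ▸ h')))]
  have hg₂per : ∀ s, g₂ (s + L) = g₂ s := by
    intro s
    have hiff : (∃ m : ℤ, s + L = m * (Real.pi / 2)) ↔ ∃ m : ℤ, s = m * (Real.pi / 2) := by
      constructor
      · rintro ⟨m, hm⟩; exact ⟨m - 4, by rw [hL] at hm; push_cast; linarith⟩
      · rintro ⟨m, hm⟩; exact ⟨m + 4, by rw [hm, hL]; push_cast; ring⟩
    simp only [hg₂]
    by_cases h : ∃ m : ℤ, s = m * (Real.pi / 2)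
    · rw [if_pos h, if_pos (hiff.2 h)]
    · rw [if_neg h, if_neg (fun h' => h (hiff.1 h'))]
  have hsumθ : ∑ j ∈ Finset.range N, ((2 / 3 : ℝ) * ((ℓ (t (j + 2)) - ℓ (t (j + 1))) / (ℓ (t (j + 1)) - ℓ (t j))).arg +
      Real.pi / 3 * markInd D (ℓ (t (j + 1)))) = ∑ j ∈ Finset.range N, g (t (j + 1)) :=
    Finset.sum_congr rfl fun j _ => (hθ j).1.1
  have hsumarg : ∑ j ∈ Finset.range N, ((ℓ (t (j + 2)) - ℓ (t (j + 1))) / (ℓ (t (j + 1)) - ℓ (t j))).arg =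
      ∑ j ∈ Finset.range N, g₂ (t (j + 1)) :=
    Finset.sum_congr rfl fun j _ => (hθ j).2.1
  -- evaluate the sum over `T`
  have hmaT : ma ∈ T := by rw [hT]; exact Finset.mem_insert_self _ _
  have hmbT : mb ∈ T := by rw [hT]; exact Finset.mem_insert_of_mem (Finset.mem_insert_self _ _)
  have hgrid_filter : T.filter (fun x => ∃ m : ℤ, x = m * (Real.pi / 2)) = C := by
    ext x
    simp only [Finset.mem_filter]
    constructor
    · rintro ⟨hxT, m, hm⟩
      have hx := hTrange x hxT
      rcases grid_mem_of_lt hm hx.1 hx.2 with rfl | rfl | rfl | rfl <;> simp [hC]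
    · intro hxC
      obtain ⟨m, hm⟩ := hCgrid x hxC
      exact ⟨hCT hxC, m, by rw [hm]; push_cast; ring⟩
  have hmark_filter : T.filter (fun x => ℓ x = D.pt 0 ∨ ℓ x = D.pt 1) = {ma, mb} := by
    ext x
    simp only [Finset.mem_filter, Finset.mem_insert, Finset.mem_singleton]
    constructor
    · rintro ⟨hxT, h | h⟩
      · left; exact hinj ⟨(hTrange x hxT).1, (hTrange x hxT).2⟩ hma (by rw [h, hℓa])
      · right; exact hinj ⟨(hTrange x hxT).1, (hTrange x hxT).2⟩ hmb (by rw [h, hℓb])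
    · rintro (rfl | rfl)
      · exact ⟨hmaT, Or.inl hℓa⟩
      · exact ⟨hmbT, Or.inr hℓb⟩
  have hsum1 : ∑ x ∈ T, (if ∃ m : ℤ, x = m * (Real.pi / 2) then Real.pi / 3 else (0:ℝ)) = Real.pi / 3 * 4 := by
    rw [← Finset.sum_filter, hgrid_filter, Finset.sum_const, hCcard, nsmul_eq_mul]; push_cast; ring
  have hsum2 : ∑ x ∈ T, markInd D (ℓ x) = 2 := by
    have h1 : ∀ x ∈ T, markInd D (ℓ x) = if (ℓ x = D.pt 0 ∨ ℓ x = D.pt 1) then (1:ℝ) else 0 := fun x _ => rfl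
    rw [Finset.sum_congr rfl h1, Finset.sum_boole, hmark_filter, Finset.card_pair hmab]; norm_num
  have htotal : ∑ x ∈ T, g x = 2 * Real.pi := by
    simp only [hg]
    rw [Finset.sum_add_distrib, ← Finset.mul_sum, hsum1, hsum2]; ring
  have hsum3 : ∑ x ∈ T, g₂ x = 2 * Real.pi := by
    simp only [hg₂]
    rw [← Finset.sum_filter, hgrid_filter, Finset.sum_const, hCcard, nsmul_eq_mul]; push_cast; ring
  refine ⟨N, ℓ, t, c, hN4, hc, hconv, hℓc, hper, hrange, hinj, ht0, htlt, htper, fun j => (hseg j).1,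
    fun j => (hseg j).2, fun j => ?_, by rw [hsumarg, hsum g₂ hg₂per, hsum3], fun j => ?_,
    by rw [hsumθ, hsum g hgper, htotal]⟩
  · rw [(hθ j).2.1]; exact (hθ j).2.2
  · rw [(hθ j).1.1]; exact (hθ j).1.2


end Summit.CriticalPhenomena.CardyFormulaZ2.Cruxes.ParafermionToSLESixFamilies.PotentialDarbouxPicardDiamond

end
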